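import Mathlib.Analysis.Complex.UpperHalfPlane.Measure
import Mathlib.NumberTheory.Modular
import Mathlib.MeasureTheory.Measure.Lebesgue.Complex
import Mathlib.MeasureTheory.Integral.Prod
import Mathlib.MeasureTheory.Integral.IntervalIntegral.Basic
import Literature.NumberTheory.EllipticCurves.HeckeOperatorsAdjointProofs
import Literature.NumberTheory.EllipticCurves.ModularDegreeFormulaDomainProofs
import HarnessLib

/-!
# The Petersson product on `Γ₀(N)` in coordinates on the standard fundamental domain

Theorems only (no definitions, no named facts). For the proof of Haberland's formula
(V. Paşol, A. A. Popa, *Modular forms and period polynomials*, Proc. LMS 107 (2013), Thm. 3.2 and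
§8.2 [PasolPopa2013]) by Stokes' theorem on the standard fundamental domain
`𝒟 = {|x| ≤ 1/2, |z| ≥ 1}` of `SL₂(ℤ)`, the tree's Petersson product
(`peterssonProduct Γ k f g = ∫_𝒟 ∑_{a ∈ 𝒮ℒ/Γ} conj(f) g yᵏ (a⁻¹τ) dμ(τ)`,
`Literature.NumberTheory.EllipticCurves.HeckeOperators`; `dμ = dx dy / y²`, Mathlib's
`UpperHalfPlane.volume`) has to be written as an iterated real integral:

* `FdCoord.setIntegral_eq_setIntegral_image` — `∫_S Φ dμ = ∫_{S ⊂ ℂ} Φ(w) y⁻² dw` (Bochner version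
  of Mathlib's `UpperHalfPlane.volume_eq_lintegral`);
* `FdCoord.setIntegral_image_fd_eq` — Fubini on `𝒟 ⊂ ℂ ≅ ℝ²`:
  `∫_𝒟 G(w) dw = ∫_{-1/2}^{1/2} ∫_{√(1-x²)}^∞ G(x+iy) dy dx`;
* `FdCoord.setIntegral_fd_eq_intervalIntegral`, `FdCoord.integrableOn_image_fd_iff` — the two
  combined, with the matching integrability criterion;
* **`peterssonProduct_eq_intervalIntegral`** — for `f, f' ∈ S_k(Γ₀(N))` and a system
  `g : 𝒮ℒ/Γ₀(N) → SL₂(ℤ)` of coset representatives,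
  `peterssonProduct (Γ₀(N)) k f f'
     = ∫_{-1/2}^{1/2} ∫_{√(1-x²)}^∞ ∑_q conj((f∣g_q⁻¹)(x+iy)) (f'∣g_q⁻¹)(x+iy) y^{k-2} dy dx`
  (Mathlib's `UpperHalfPlane.petersson_slash_SL`: `conj(f) f' yᵏ (γτ) = conj(f∣γ) (f'∣γ) yᵏ (τ)`),
  together with the integrability of the integrand (`CuspFormClass.petersson_bounded_left`,
  `volume_fd_lt_top`).

## References

* [PasolPopa2013] V. Paşol, A. A. Popa, Proc. LMS 107 (2013) 713–743, arXiv:1202.5802: (3.1) and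
  the proof of Thm. 3.2 / §8.2.
* [DiamondShurman2005] F. Diamond, J. Shurman, *A First Course in Modular Forms*, §5.4
  (Def. 5.4.1, the measure `dμ(τ) = dx dy / y²`).
-/

noncomputable section

open MeasureTheory Set Filter Topology Complex
open scoped NNReal ENNReal MatrixGroups ModularForm

namespace Literature.NumberTheory.EllipticCurves.ModularForms

namespace FdCoord

/-- The density `y⁻²` of the invariant measure is measurable. [folklore] -/
theorem measurable_density :
    Measurable fun z : UpperHalfPlane ↦ (1 / NNReal.mk z.im z.im_pos.le : ℝ≥0) ^ 2 := by
  refine Measurable.pow_const (Measurable.div measurable_const ?_) _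
  exact (UpperHalfPlane.continuous_im.subtype_mk _).measurable

/-- **A set integral on `ℍ` in the coordinates of `ℂ`**: `∫_S Φ dμ = ∫_{S ⊂ ℂ} Φ(w) (im w)⁻² dw`
(`dμ = dx dy / y²`). [folklore] -/
theorem setIntegral_eq_setIntegral_image (Φ : UpperHalfPlane → ℂ) {S : Set UpperHalfPlane}
    (hS : MeasurableSet S) :
    ∫ τ in S, Φ τ = ∫ w in ((↑) : UpperHalfPlane → ℂ) '' S,
      ((1 / w.im ^ 2 : ℝ) : ℂ) * Φ (UpperHalfPlane.ofComplex w) := by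
  rw [UpperHalfPlane.volume_def,
    setIntegral_withDensity_eq_setIntegral_smul (μ := volume.comap UpperHalfPlane.coe)
      (f := fun z : UpperHalfPlane ↦ (1 / NNReal.mk z.im z.im_pos.le : ℝ≥0) ^ 2) measurable_density Φ hS]
  have hmp : MeasurePreserving UpperHalfPlane.coe (volume.comap UpperHalfPlane.coe)
      (volume.restrict (Set.range UpperHalfPlane.coe)) :=
    ⟨UpperHalfPlane.measurable_coe, by rw [UpperHalfPlane.measurableEmbedding_coe.map_comap]⟩
  have h2 := hmp.setIntegral_image_emb UpperHalfPlane.measurableEmbedding_coe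
    (fun w : ℂ ↦ ((1 / w.im ^ 2 : ℝ) : ℂ) * Φ (UpperHalfPlane.ofComplex w)) S
  rw [Measure.restrict_restrict (UpperHalfPlane.measurableEmbedding_coe.measurableSet_image.mpr hS),
    inter_eq_left.mpr (image_subset_range _ _)] at h2
  rw [h2]
  refine setIntegral_congr_fun hS fun z _ ↦ ?_
  simp only [UpperHalfPlane.ofComplex_apply, NNReal.smul_def, NNReal.coe_pow, NNReal.coe_div,
    NNReal.coe_one, NNReal.coe_mk, Complex.real_smul, UpperHalfPlane.coe_im]
  push_cast
  ring_nf

/-- The image of the standard fundamental domain in `ℂ`. [folklore] -/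
theorem mem_image_fd_iff (w : ℂ) :
    w ∈ ((↑) : UpperHalfPlane → ℂ) '' ModularGroup.fd ↔ 0 < w.im ∧ 1 ≤ Complex.normSq w ∧ |w.re| ≤ 1 / 2 := by
  constructor
  · rintro ⟨z, hz, rfl⟩
    exact ⟨z.im_pos, hz.1, hz.2⟩
  · rintro ⟨him, h1, h2⟩
    exact ⟨⟨w, him⟩, ⟨h1, h2⟩, rfl⟩

/-- Measurability of the image of the fundamental domain. [folklore] -/
theorem measurableSet_image_fd :
    MeasurableSet (((↑) : UpperHalfPlane → ℂ) '' ModularGroup.fd) :=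
  UpperHalfPlane.measurableEmbedding_coe.measurableSet_image.mpr ModularGroup.isClosed_fd.measurableSet

/-- The vertical slice of the fundamental domain above `x`, `|x| ≤ 1/2`, is `[√(1 - x²), ∞)`. [folklore] -/
theorem slice_eq_Ici {x : ℝ} (hx : |x| ≤ 1 / 2) :
    {y : ℝ | 0 < y ∧ 1 ≤ x ^ 2 + y ^ 2} = Ici (Real.sqrt (1 - x ^ 2)) := by
  have hx2 : x ^ 2 ≤ 1 / 4 := by
    have h : |x| ^ 2 ≤ (1 / 2) ^ 2 := by gcongr
    rw [sq_abs] at h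
    linarith
  have hpos : 0 < 1 - x ^ 2 := by linarith
  ext y
  simp only [mem_setOf_eq, mem_Ici]
  constructor
  · rintro ⟨hy, h⟩
    have : Real.sqrt (1 - x ^ 2) ≤ Real.sqrt (y ^ 2) := Real.sqrt_le_sqrt (by linarith)
    rwa [Real.sqrt_sq hy.le] at this
  · intro h
    have hs : 0 < Real.sqrt (1 - x ^ 2) := Real.sqrt_pos.mpr hpos
    refine ⟨hs.trans_le h, ?_⟩
    have : Real.sqrt (1 - x ^ 2) ^ 2 ≤ y ^ 2 := by gcongr
    rw [Real.sq_sqrt hpos.le] at this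
    linarith

/-- **Integration over the image of the fundamental domain in coordinates** (Fubini):
`∫_{𝔉} G(w) dw = ∫_{-1/2}^{1/2} ∫_{√(1-x²)}^∞ G(x + iy) dy dx` for `G` integrable on `𝔉 ⊂ ℂ`. [folklore] -/
theorem setIntegral_image_fd_eq (G : ℂ → ℂ)
    (hG : IntegrableOn G (((↑) : UpperHalfPlane → ℂ) '' ModularGroup.fd)) :
    ∫ w in ((↑) : UpperHalfPlane → ℂ) '' ModularGroup.fd, G w =
      ∫ x in (-(1 / 2) : ℝ)..(1 / 2), ∫ y in Ioi (Real.sqrt (1 - x ^ 2)), G ((x : ℂ) + y * I) := by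
  set A : Set ℂ := ((↑) : UpperHalfPlane → ℂ) '' ModularGroup.fd with hA
  set e := Complex.measurableEquivRealProd with he
  have hsymm : MeasurePreserving e.symm volume volume := Complex.volume_preserving_equiv_real_prod.symm e
  have h1 := hsymm.setIntegral_preimage_emb e.symm.measurableEmbedding G A
  rw [← h1]
  set B : Set (ℝ × ℝ) := e.symm ⁻¹' A with hB
  have hBmeas : MeasurableSet B := e.symm.measurable measurableSet_image_fd
  have hmemB : ∀ p : ℝ × ℝ, p ∈ B ↔ 0 < p.2 ∧ 1 ≤ p.1 ^ 2 + p.2 ^ 2 ∧ |p.1| ≤ 1 / 2 := by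
    intro p
    rw [hB, mem_preimage, hA, mem_image_fd_iff, he, Complex.measurableEquivRealProd_symm_apply,
      Complex.normSq_mk]
    simp only
    constructor <;> rintro ⟨h1, h2, h3⟩ <;> exact ⟨h1, by nlinarith [h2], h3⟩
  have hHint : IntegrableOn (fun p : ℝ × ℝ ↦ G (e.symm p)) B :=
    (hsymm.integrableOn_comp_preimage e.symm.measurableEmbedding).mpr hG
  have hesymm : ∀ p : ℝ × ℝ, e.symm p = (p.1 : ℂ) + p.2 * I := by
    intro p
    rw [he, Complex.measurableEquivRealProd_symm_apply, Complex.mk_eq_add_mul_I]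
  rw [← integral_indicator hBmeas, Measure.volume_eq_prod, integral_prod _ (hHint.integrable_indicator hBmeas)]
  -- the inner integral, slice by slice
  have hslice : ∀ x : ℝ, ∫ y : ℝ, B.indicator (fun p : ℝ × ℝ ↦ G (e.symm p)) (x, y) =
      (Icc (-(1 / 2) : ℝ) (1 / 2)).indicator
        (fun x : ℝ ↦ ∫ y in Ioi (Real.sqrt (1 - x ^ 2)), G ((x : ℂ) + y * I)) x := by
    intro x
    by_cases hx : |x| ≤ 1 / 2
    · have hxI : x ∈ Icc (-(1 / 2) : ℝ) (1 / 2) := by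
        rw [mem_Icc]; constructor <;> linarith [abs_le.mp hx |>.1, abs_le.mp hx |>.2]
      rw [indicator_of_mem hxI]
      have hind : (fun y : ℝ ↦ B.indicator (fun p : ℝ × ℝ ↦ G (e.symm p)) (x, y)) =
          (Ici (Real.sqrt (1 - x ^ 2))).indicator fun y : ℝ ↦ G ((x : ℂ) + y * I) := by
        funext y
        rw [← slice_eq_Ici hx]
        by_cases hy : (x, y) ∈ B
        · rw [indicator_of_mem hy, indicator_of_mem, hesymm]
          exact ⟨(hmemB _).mp hy |>.1, (hmemB _).mp hy |>.2.1⟩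
        · rw [indicator_of_notMem hy, indicator_of_notMem]
          intro hy'
          exact hy ((hmemB _).mpr ⟨hy'.1, hy'.2, hx⟩)
      rw [hind, integral_indicator measurableSet_Ici, integral_Ici_eq_integral_Ioi]
    · have hxI : x ∉ Icc (-(1 / 2) : ℝ) (1 / 2) := by
        intro h
        rw [mem_Icc] at h
        exact hx (abs_le.mpr ⟨by linarith, by linarith⟩)
      rw [indicator_of_notMem hxI]
      have hind : (fun y : ℝ ↦ B.indicator (fun p : ℝ × ℝ ↦ G (e.symm p)) (x, y)) = fun _ ↦ 0 := by
        funext y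
        rw [indicator_of_notMem]
        intro hy
        exact hx ((hmemB _).mp hy).2.2
      rw [hind, integral_zero]
  simp_rw [hslice]
  rw [integral_indicator measurableSet_Icc, intervalIntegral.integral_of_le (by norm_num),
    setIntegral_congr_set Ioc_ae_eq_Icc]

/-- **A set integral over the standard fundamental domain in coordinates**:
`∫_𝒟 Φ dμ = ∫_{-1/2}^{1/2} ∫_{√(1-x²)}^∞ Φ(x + iy) y⁻² dy dx` whenever `w ↦ Φ(w)/ (im w)²` is
integrable on `𝒟 ⊂ ℂ` (`dμ = dx dy / y²`, Mathlib's `UpperHalfPlane.volume`). [folklore] -/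
theorem setIntegral_fd_eq_intervalIntegral (Φ : UpperHalfPlane → ℂ)
    (hΦ : IntegrableOn (fun w : ℂ ↦ ((1 / w.im ^ 2 : ℝ) : ℂ) * Φ (UpperHalfPlane.ofComplex w))
      (((↑) : UpperHalfPlane → ℂ) '' ModularGroup.fd)) :
    ∫ τ in ModularGroup.fd, Φ τ =
      ∫ x in (-(1 / 2) : ℝ)..(1 / 2), ∫ y in Ioi (Real.sqrt (1 - x ^ 2)),
        ((1 / y ^ 2 : ℝ) : ℂ) * Φ (UpperHalfPlane.ofComplex ((x : ℂ) + y * I)) := by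
  rw [setIntegral_eq_setIntegral_image Φ ModularGroup.isClosed_fd.measurableSet,
    setIntegral_image_fd_eq _ hΦ]
  refine intervalIntegral.integral_congr fun x _ ↦ ?_
  refine setIntegral_congr_fun measurableSet_Ioi fun y _ ↦ ?_
  simp

/-- **Integrability criterion in coordinates**: `w ↦ Φ(w) (im w)⁻²` is integrable on `S ⊂ ℂ` iff
`Φ` is integrable on `S` for `dμ`. [folklore] -/
theorem integrableOn_image_iff (Φ : UpperHalfPlane → ℂ) {S : Set UpperHalfPlane}
    (hS : MeasurableSet S) :
    IntegrableOn (fun w : ℂ ↦ ((1 / w.im ^ 2 : ℝ) : ℂ) * Φ (UpperHalfPlane.ofComplex w))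
      (((↑) : UpperHalfPlane → ℂ) '' S) ↔ IntegrableOn Φ S := by
  have hmp : MeasurePreserving UpperHalfPlane.coe (volume.comap UpperHalfPlane.coe)
      (volume.restrict (Set.range UpperHalfPlane.coe)) :=
    ⟨UpperHalfPlane.measurable_coe, by rw [UpperHalfPlane.measurableEmbedding_coe.map_comap]⟩
  have h1 : IntegrableOn Φ S ↔ Integrable (fun z : UpperHalfPlane ↦
      ((1 / NNReal.mk z.im z.im_pos.le : ℝ≥0) ^ 2) • Φ z) ((volume.comap UpperHalfPlane.coe).restrict S) := by
    rw [IntegrableOn, UpperHalfPlane.volume_def, restrict_withDensity hS,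
      integrable_withDensity_iff_integrable_smul measurable_density]
  have h2 := hmp.integrableOn_comp_preimage UpperHalfPlane.measurableEmbedding_coe
    (f := fun w : ℂ ↦ ((1 / w.im ^ 2 : ℝ) : ℂ) * Φ (UpperHalfPlane.ofComplex w))
    (s := ((↑) : UpperHalfPlane → ℂ) '' S)
  rw [preimage_image_eq _ UpperHalfPlane.measurableEmbedding_coe.injective, IntegrableOn,
    IntegrableOn, Measure.restrict_restrict (UpperHalfPlane.measurableEmbedding_coe.measurableSet_image.mpr hS),
    inter_eq_left.mpr (image_subset_range _ _)] at h2
  rw [IntegrableOn, ← h2, h1]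
  refine integrable_congr (Eventually.of_forall fun z ↦ ?_)
  simp only [Function.comp_apply, UpperHalfPlane.ofComplex_apply, NNReal.smul_def, NNReal.coe_pow,
    NNReal.coe_div, NNReal.coe_one, NNReal.coe_mk, Complex.real_smul, UpperHalfPlane.coe_im]
  push_cast
  ring_nf

end FdCoord

/-! ### The Petersson product on `Γ₀(N)` in coordinates -/

section Petersson

open UpperHalfPlane hiding I

variable {N : ℕ} (g : (↥𝒮ℒ ⧸ (CongruenceSubgroup.Gamma0 N : Subgroup (GL (Fin 2) ℝ)).subgroupOf 𝒮ℒ) → SL(2, ℤ))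
  (hg : ∀ q, (Matrix.SpecialLinearGroup.mapGL ℝ (g q) : GL (Fin 2) ℝ) = ((q.out : ↥𝒮ℒ) : GL (Fin 2) ℝ))

/-- The Petersson integrand of slashed cusp forms `conj(f∣γ) (f'∣γ) yᵏ` is integrable on `𝒟`
(it is `conj(f) f' yᵏ ∘ γ`, bounded and continuous, and `𝒟` has finite volume). [folklore] -/
theorem integrableOn_petersson_slash_fd {Γ : Subgroup (GL (Fin 2) ℝ)} [Γ.IsArithmetic] (k : ℤ)
    (f f' : CuspForm Γ k) (γ : SL(2, ℤ)) :
    IntegrableOn (petersson k (⇑f ∣[k] γ) (⇑f' ∣[k] γ)) ModularGroup.fd := by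
  obtain ⟨C, hC⟩ := CuspFormClass.petersson_bounded_left k Γ f f'
  have hfun : petersson k (⇑f ∣[k] γ) (⇑f' ∣[k] γ) = fun τ ↦ petersson k ⇑f ⇑f' (γ • τ) := by
    funext τ
    exact petersson_slash_SL k ⇑f ⇑f' γ τ
  rw [hfun]
  refine Measure.integrableOn_of_bounded volume_fd_lt_top.ne ?_ (ae_of_all _ fun τ ↦ hC _)
  have hγ : Continuous fun τ : UpperHalfPlane ↦ γ • τ := by
    change Continuous fun τ : UpperHalfPlane ↦ (Matrix.SpecialLinearGroup.mapGL ℝ γ : GL (Fin 2) ℝ) • τ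
    exact continuous_const_smul _
  have hc : Continuous fun τ : UpperHalfPlane ↦ petersson k ⇑f ⇑f' (γ • τ) :=
    (show Continuous (petersson k ⇑f ⇑f') by fun_prop).comp hγ
  exact hc.aestronglyMeasurable

include hg in
/-- **The Petersson product on `Γ₀(N)` in coordinates on the standard fundamental domain**:
for a system `g : 𝒮ℒ/Γ₀(N) → SL₂(ℤ)` of coset representatives,
`peterssonProduct (Γ₀(N)) k f f' = ∫_{-1/2}^{1/2} ∫_{√(1-x²)}^∞ ∑_q conj((f∣g_q⁻¹)(x+iy))
(f'∣g_q⁻¹)(x+iy) y^{k-2} dy dx` (`dμ = dx dy/y²`; Paşol–Popa (3.1),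
`∫_{Γ\ℍ} f ḡ yᵏ dμ = ∑_A ∫_𝔉 f∣A \overline{g∣A} yᵏ dμ`). [cite: PasolPopa2013, (3.1) and §8.2] -/
theorem peterssonProduct_eq_intervalIntegral [NeZero N]
    [Fintype (↥𝒮ℒ ⧸ (CongruenceSubgroup.Gamma0 N : Subgroup (GL (Fin 2) ℝ)).subgroupOf 𝒮ℒ)] (k : ℤ)
    (f f' : CuspForm (CongruenceSubgroup.Gamma0 N) k) :
    peterssonProduct (CongruenceSubgroup.Gamma0 N) k f f' =
      ∫ x in (-(1 / 2) : ℝ)..(1 / 2), ∫ y in Ioi (Real.sqrt (1 - x ^ 2)),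
        ∑ q, (starRingEnd ℂ) ((⇑f ∣[k] ((g q)⁻¹ : SL(2, ℤ))) (ofComplex ((x : ℂ) + y * I))) *
          (⇑f' ∣[k] ((g q)⁻¹ : SL(2, ℤ))) (ofComplex ((x : ℂ) + y * I)) * (y : ℂ) ^ (k - 2) := by
  rw [peterssonProduct_eq_setIntegral]
  have hpt : ∀ q (τ : UpperHalfPlane), petersson k ⇑f ⇑f' (((q.out : ↥𝒮ℒ) : GL (Fin 2) ℝ)⁻¹ • τ) =
      petersson k (⇑f ∣[k] ((g q)⁻¹ : SL(2, ℤ))) (⇑f' ∣[k] ((g q)⁻¹ : SL(2, ℤ))) τ := by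
    intro q τ
    have hsm : ((q.out : ↥𝒮ℒ) : GL (Fin 2) ℝ)⁻¹ • τ = (g q)⁻¹ • τ := by
      rw [← hg q, ← map_inv]; rfl
    rw [hsm, petersson_slash_SL]
  simp_rw [hpt]
  have hint : IntegrableOn (fun τ : UpperHalfPlane ↦ ∑ q,
      petersson k (⇑f ∣[k] ((g q)⁻¹ : SL(2, ℤ))) (⇑f' ∣[k] ((g q)⁻¹ : SL(2, ℤ))) τ) ModularGroup.fd :=
    integrable_finsetSum _ fun q _ ↦ integrableOn_petersson_slash_fd k f f' _
  rw [FdCoord.setIntegral_fd_eq_intervalIntegral _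
    ((FdCoord.integrableOn_image_iff _ ModularGroup.isClosed_fd.measurableSet).mpr hint)]
  refine intervalIntegral.integral_congr fun x _ ↦ ?_
  refine setIntegral_congr_fun measurableSet_Ioi fun y hy ↦ ?_
  have hy0 : 0 < y := (Real.sqrt_nonneg _).trans_lt hy
  have him : 0 < ((x : ℂ) + y * I).im := by simpa using hy0
  have himpt : ((ofComplex ((x : ℂ) + y * I) : UpperHalfPlane).im : ℝ) = y := by
    rw [← UpperHalfPlane.coe_im, ofComplex_apply_of_im_pos him]
    simp
  simp only [Finset.mul_sum]
  refine Finset.sum_congr rfl fun q _ ↦ ?_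
  rw [petersson, himpt]
  have hy' : (y : ℂ) ≠ 0 := by exact_mod_cast hy0.ne'
  rw [zpow_sub₀ hy', zpow_two]
  push_cast
  field_simp

end Petersson

end Literature.NumberTheory.EllipticCurves.ModularForms
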